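import Literature.AlgebraicGeometry.Frobenioids.PerfFactorialOrderIso
import Literature.AlgebraicGeometry.Frobenioids.Thm42PrimaryStepsReflect
import HarnessLib

/-!
# [FrdI] Thm. 4.9: the divisor transport `Φ₁(A) → Φ₂(ΨA)`, `Div φ ↦ Div Ψ(φ)`, and its upgrade to an
# isomorphism of monoids from the ray isomorphisms of Thm. 4.2 (iii)

Mochizuki, *The geometry of Frobenioids I: the general theory*, Kyushu J. Math. **62** (2008)
293–400, §4, Theorem 4.9 (Category-theoreticity of divisor monoids), proof p. 89 ll. 6–36 (kurims)
[cite: MochizukiFrdI2008, Thm. 4.9 p.88].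

PROOF-ONLY (no new definitions). For Frobenioids `C_i → F_{Φ_i}` of isotropic type and an equivalence
`Ψ : C₁ ≌ C₂` such that `Ψ`, `Ψ⁻¹` preserve pre-steps (Thm. 3.4 (ii)):
* `PreFrobenioid.exists_divTransport` — "by applying the first equivalence of categories of Definition
  1.3, (iii), (d), to obtain pre-steps `φ : A → B` with arbitrary prescribed zero divisor" (p. 89 l. 25–27):
  the map `T_A : Φ₁(A) → Φ₂(ΨA)`, `Div(φ) ↦ Div(Ψφ)` (any co-angular pre-step `φ` out of `A`) is
  well defined, bijective, and `x ≤ y ↔ T_A x ≤ T_A y`;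
* `PreFrobenioid.exists_mulEquiv_div_map` — if moreover the `C_i` are of perfect type, `Φ_i`
  perf-factorial, and on every prime ray `Φ₁(A)_𝔭` there is an isomorphism of monoids onto a ray of
  `Φ₂(ΨA)` computing `Div ∘ Ψ` (the right-hand isomorphisms of Thm. 4.2 (iii), `PreFrobenioid.exists_rightIso`,
  seat abc-iut-L1-t14), then `T_A` is an ISOMORPHISM OF MONOIDS `Φ₁(A) ≃* Φ₂(ΨA)` with
  `T_A (Div φ) = Div (Ψφ)` for every pre-step `φ` out of `A` — the per-object half of "`Ψ^Prime`
  extends … to an isomorphism of monoids `Φ₁(A₁) ≅ Φ₂(A₂)`" (p. 89 ll. 10–33), by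
  `IsPerfFactorial.map_mul_of_dvd_iff_of_rays`. (Functoriality in `A` — the "right-hand = left-hand"
  part of the printed proof — is not treated here.)
Nothing here bears on [IUTchIII].
-/

namespace Literature.AlgebraicGeometry.Frobenioids

open CategoryTheory Opposite

universe w v v' u u'

namespace PreFrobenioid

variable {D₁ : Type u} [Category.{v} D₁] {Φ₁ : D₁ᵒᵖ ⥤ CommMonCat.{w}} {C₁ : Type u'} [Category.{v'} C₁]
  {D₂ : Type u} [Category.{v} D₂] {Φ₂ : D₂ᵒᵖ ⥤ CommMonCat.{w}} {C₂ : Type u'} [Category.{v'} C₂]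
  {F₁ : C₁ ⥤ ElemFrobenioid Φ₁} {F₂ : C₂ ⥤ ElemFrobenioid Φ₂}

/-- Co-angular pre-steps out of `A` with the same zero divisor have images under `Ψ` with the same zero
divisor (Def. 1.3 (iii)(d): they factor through each other). [cite: MochizukiFrdI2008, Thm. 4.9 p.89] -/
theorem div_map_eq_of_div_eq (Ψ : C₁ ≌ C₂) (hF₁ : IsFrobenioid F₁) (hF₂ : IsFrobenioid F₂)
    {A B B' : C₁} {φ : A ⟶ B} {φ' : A ⟶ B'} (hφ : IsCoAngularPreStep F₁ φ)
    (hφ' : IsCoAngularPreStep F₁ φ') (he : Div F₁ φ = Div F₁ φ') :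
    Div F₂ (Ψ.functor.map φ) = Div F₂ (Ψ.functor.map φ') := by
  haveI : IsCancelMul (Φ₂.obj (op (baseObj F₂ (Ψ.functor.obj A)))) := isIntegral_iff_isCancelMul.mp
    (hF₂.isPreFrobenioid.isDivisorial _).isPreDivisorial.isIntegral
  obtain ⟨g, -, hg⟩ := hF₁.iii_d_under_full φ φ' hφ hφ' (he ▸ dvd_rfl)
  obtain ⟨g', -, hg'⟩ := hF₁.iii_d_under_full φ' φ hφ' hφ (he ▸ dvd_rfl)
  refine dvd_antisymm_of_isSharp (hF₂.isPreFrobenioid.isDivisorial _).isSharp ?_ ?_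
  · rw [← hg, Functor.map_comp]; exact div_dvd_div_comp _ _
  · rw [← hg', Functor.map_comp]; exact div_dvd_div_comp _ _

/-- **The divisor transport `T_A : Φ₁(A) → Φ₂(ΨA)`, `Div(φ) ↦ Div(Ψφ)`** (p. 89 l. 25–27: "by applying
the first equivalence of categories of Definition 1.3, (iii), (d), to obtain pre-steps `φ : A → B` with
arbitrary prescribed zero divisor"): for Frobenioids of isotropic type and `Ψ` an equivalence such that
`Ψ`, `Ψ⁻¹` preserve pre-steps, there is a bijection `T : Φ₁(A) → Φ₂(ΨA)` with `x ≤ y ↔ T x ≤ T y` and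
`T (Div φ) = Div (Ψφ)` for every pre-step `φ` out of `A`. [cite: MochizukiFrdI2008, Thm. 4.9 p.89] -/
theorem exists_divTransport (Ψ : C₁ ≌ C₂) (hF₁ : IsFrobenioid F₁) (hF₂ : IsFrobenioid F₂)
    (histr₁ : IsOfIsotropicType F₁) (histr₂ : IsOfIsotropicType F₂)
    (hpre : ∀ ⦃X Y : C₁⦄ (φ : X ⟶ Y), IsPreStep F₁ φ → IsPreStep F₂ (Ψ.functor.map φ))
    (hpre' : ∀ ⦃X Y : C₂⦄ (φ : X ⟶ Y), IsPreStep F₂ φ → IsPreStep F₁ (Ψ.inverse.map φ)) (A : C₁) :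
    ∃ T : Φ₁.obj (op (baseObj F₁ A)) → Φ₂.obj (op (baseObj F₂ (Ψ.functor.obj A))),
      Function.Bijective T ∧ (∀ x y, x ∣ y ↔ T x ∣ T y) ∧
        ∀ ⦃B : C₁⦄ (φ : A ⟶ B), IsPreStep F₁ φ → T (Div F₁ φ) = Div F₂ (Ψ.functor.map φ) := by
  have hco₁ : ∀ {X Y : C₁} (f : X ⟶ Y), IsCoAngular F₁ f :=
    fun f => isCoAngular_of_isIsotropic_codomains F₁ f fun Z _ => histr₁ Z
  have hco₂ : ∀ {X Y : C₂} (f : X ⟶ Y), IsCoAngular F₂ f :=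
    fun f => isCoAngular_of_isIsotropic_codomains F₂ f fun Z _ => histr₂ Z
  haveI : IsCancelMul (Φ₁.obj (op (baseObj F₁ A))) := isIntegral_iff_isCancelMul.mp
    (hF₁.isPreFrobenioid.isDivisorial _).isPreDivisorial.isIntegral
  -- a co-angular pre-step `φo x : A → Bo x` with `Div (φo x) = x`, for every `x ∈ Φ₁(A)`
  choose Bo φo hφo hφox using fun x : Φ₁.obj (op (baseObj F₁ A)) => hF₁.iii_d_under_surj A x
  have hT : ∀ ⦃B : C₁⦄ (φ : A ⟶ B), IsPreStep F₁ φ →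
      Div F₂ (Ψ.functor.map (φo (Div F₁ φ))) = Div F₂ (Ψ.functor.map φ) :=
    fun B φ hφ => div_map_eq_of_div_eq Ψ hF₁ hF₂ (hφo _) ⟨hco₁ φ, hφ⟩ (hφox _)
  have hdvd : ∀ x y, x ∣ y ↔ Div F₂ (Ψ.functor.map (φo x)) ∣ Div F₂ (Ψ.functor.map (φo y)) := by
    intro x y
    constructor
    · intro h
      obtain ⟨g, -, hg⟩ := hF₁.iii_d_under_full (φo x) (φo y) (hφo x) (hφo y)
        (by rw [hφox, hφox]; exact h)
      rw [← hg, Functor.map_comp]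
      exact div_dvd_div_comp _ _
    · intro h
      obtain ⟨g', -, hg'⟩ := hF₂.iii_d_under_full (Ψ.functor.map (φo x)) (Ψ.functor.map (φo y))
        ⟨hco₂ _, hpre _ (hφo x).2⟩ ⟨hco₂ _, hpre _ (hφo y).2⟩ h
      have hfac : φo x ≫ Ψ.functor.preimage g' = φo y :=
        Ψ.functor.map_injective (by rw [Functor.map_comp, Functor.map_preimage, hg'])
      rw [← hφox x, ← hφox y, ← hfac]
      exact div_dvd_div_comp _ _
  refine ⟨fun x => Div F₂ (Ψ.functor.map (φo x)), ⟨fun x y hxy => ?_, fun y => ?_⟩, hdvd, hT⟩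
  · -- injective: mutual divisibility
    have hxy' : Div F₂ (Ψ.functor.map (φo x)) = Div F₂ (Ψ.functor.map (φo y)) := hxy
    exact dvd_antisymm_of_isSharp (hF₁.isPreFrobenioid.isDivisorial _).isSharp
      ((hdvd x y).mpr (hxy' ▸ dvd_rfl)) ((hdvd y x).mpr (hxy' ▸ dvd_rfl))
  · -- surjective: pull a pre-step with divisor `y` back along the fully faithful `Ψ`
    obtain ⟨B', ψ, hψ, hψy⟩ := hF₂.iii_d_under_surj (Ψ.functor.obj A) y
    let e : Ψ.functor.obj (Ψ.functor.objPreimage B') ≅ B' := Ψ.functor.objObjPreimageIso B'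
    let φ : A ⟶ Ψ.functor.objPreimage B' := Ψ.functor.preimage (ψ ≫ e.inv)
    have hφm : Ψ.functor.map φ = ψ ≫ e.inv := Ψ.functor.map_preimage _
    have hφ : IsPreStep F₁ φ := isPreStep_of_map_of_inverse Ψ hF₁ hpre' φ (by
      rw [hφm]; exact IsPreStep.comp F₂ hψ.2 (isPreStep_of_isIso F₂ _))
    refine ⟨Div F₁ φ, ?_⟩
    show Div F₂ (Ψ.functor.map (φo (Div F₁ φ))) = y
    rw [hT φ hφ, hφm, div_comp, isIsometry_of_isIso F₂ hF₂.isPreFrobenioid e.inv, map_one, one_mul,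
      show degFr F₂ e.inv = 1 from isLinear_of_isIso F₂ _, PNat.one_coe, pow_one, hψy]

/-- **`Ψ^Φ(A)` at an object with ray isomorphisms** (p. 89 ll. 10–33, per-object half): for Frobenioids
of perfect and isotropic type with `Φ_i` perf-factorial and `Ψ` as above, if on every prime ray
`Φ₁(A)_𝔭` there is an isomorphism of monoids onto some ray `Φ₂(ΨA)_𝔭'` computing `Div ∘ Ψ` on the
co-angular pre-steps out of `A` (Thm. 4.2 (iii), right-hand isomorphisms), then the divisor transport is
an isomorphism of monoids `Φ₁(A) ≃* Φ₂(ΨA)` computing `Div ∘ Ψ` on all pre-steps out of `A`.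
[cite: MochizukiFrdI2008, Thm. 4.9 p.89] -/
theorem exists_mulEquiv_div_map (Ψ : C₁ ≌ C₂) (hF₁ : IsFrobenioid F₁) (hF₂ : IsFrobenioid F₂)
    (hperf₁ : IsOfPerfectType F₁) (hperf₂ : IsOfPerfectType F₂)
    (histr₁ : IsOfIsotropicType F₁) (histr₂ : IsOfIsotropicType F₂)
    (hpf₁ : Objectwise (fun M _ => IsPerfFactorial M) Φ₁)
    (hpf₂ : Objectwise (fun M _ => IsPerfFactorial M) Φ₂)
    (hpre : ∀ ⦃X Y : C₁⦄ (φ : X ⟶ Y), IsPreStep F₁ φ → IsPreStep F₂ (Ψ.functor.map φ))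
    (hpre' : ∀ ⦃X Y : C₂⦄ (φ : X ⟶ Y), IsPreStep F₂ φ → IsPreStep F₁ (Ψ.inverse.map φ)) (A : C₁)
    (hrays : ∀ 𝔭 : Primes (Φ₁.obj (op (baseObj F₁ A))),
      ∃ (𝔭' : Primes (Φ₂.obj (op (baseObj F₂ (Ψ.functor.obj A)))))
        (r : 𝔭.submonoid ≃* 𝔭'.submonoid),
        ∀ ⦃B : C₁⦄ (φ : A ⟶ B), IsCoAngularPreStep F₁ φ → ∀ h : Div F₁ φ ∈ 𝔭.submonoid,
          (r ⟨Div F₁ φ, h⟩ : Φ₂.obj (op (baseObj F₂ (Ψ.functor.obj A)))) = Div F₂ (Ψ.functor.map φ)) :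
    ∃ m : Φ₁.obj (op (baseObj F₁ A)) ≃* Φ₂.obj (op (baseObj F₂ (Ψ.functor.obj A))),
      ∀ ⦃B : C₁⦄ (φ : A ⟶ B), IsPreStep F₁ φ → m (Div F₁ φ) = Div F₂ (Ψ.functor.map φ) := by
  have hco₁ : ∀ {X Y : C₁} (f : X ⟶ Y), IsCoAngular F₁ f :=
    fun f => isCoAngular_of_isIsotropic_codomains F₁ f fun Z _ => histr₁ Z
  obtain ⟨T, hTb, hTd, hT⟩ := exists_divTransport Ψ hF₁ hF₂ histr₁ histr₂ hpre hpre' A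
  have hM : IsPerfFactorial (Φ₁.obj (op (baseObj F₁ A))) := hpf₁ _
  have hN : IsPerfFactorial (Φ₂.obj (op (baseObj F₂ (Ψ.functor.obj A)))) := hpf₂ _
  have hMp := isPerfect_divisorMonoid hF₁ hperf₁ A
  have hNp := isPerfect_divisorMonoid hF₂ hperf₂ (Ψ.functor.obj A)
  -- `T` is multiplicative on every ray, by the ray isomorphisms
  have hray : ∀ x y : Φ₁.obj (op (baseObj F₁ A)), IsPrimary x → IsPrimary y → x ≼ y →
      T (x * y) = T x * T y := by
    intro x y hx hy hxy
    let 𝔭 : Primes (Φ₁.obj (op (baseObj F₁ A))) := Quotient.mk (primarySetoid _) ⟨y, hy⟩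
    have hyp : y ∈ 𝔭.carrier := mem_carrier_mk_of_isPrimary hy
    have hym : y ∈ 𝔭.submonoid := Submonoid.subset_closure hyp
    have hxm : x ∈ 𝔭.submonoid := Submonoid.subset_closure (𝔭.mem_carrier_of_precsim hyp hx.1 hxy)
    have hxym : x * y ∈ 𝔭.submonoid := mul_mem hxm hym
    obtain ⟨𝔭', r, hr⟩ := hrays 𝔭
    -- realise `x`, `y`, `x y` as zero divisors of co-angular pre-steps out of `A`
    have hTr : ∀ (z : Φ₁.obj (op (baseObj F₁ A))) (hz : z ∈ 𝔭.submonoid),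
        T z = (r ⟨z, hz⟩ : Φ₂.obj (op (baseObj F₂ (Ψ.functor.obj A)))) := by
      intro z hz
      obtain ⟨B, φ, hφ, hφz⟩ := hF₁.iii_d_under_surj A z
      subst hφz
      rw [hT φ hφ.2, hr φ hφ hz]
    rw [hTr _ hxym, hTr _ hxm, hTr _ hym, ← Submonoid.coe_mul, ← map_mul]
    rfl
  have hmul := IsPerfFactorial.map_mul_of_dvd_iff_of_rays hM hN hMp hNp T hTb hTd hray
  have h1 : T 1 = 1 := map_one_of_dvd_iff hN.isDivisorial.isSharp T hTb.2 hTd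
  let Tm : Φ₁.obj (op (baseObj F₁ A)) →* Φ₂.obj (op (baseObj F₂ (Ψ.functor.obj A))) :=
    { toFun := T, map_one' := h1, map_mul' := hmul }
  exact ⟨MulEquiv.ofBijective Tm hTb, fun B φ hφ => hT φ hφ⟩

end PreFrobenioid

end Literature.AlgebraicGeometry.Frobenioids
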